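import Mathlib

/-!
# SoloBlind — the level-44 Koblitz–Ogus class survives level-raising to 88

Finite certificates behind `paper/weil-transport.md` §8.3 (LEMMA 8.1, CONJECTURE L / Φ for the level-44
class) of the solo-blind programme on the Kontsevich–Zagier conjecture; companion of
`SoloBlindLevelRaising35` (the level-35 class at level 70), `SoloBlindKubertDasDoubles`
(`2·v44 ∈ R₄₄ + MU₄₄`) and `SoloBlindZ33Outright` (the level-33 class dies at level 66).

A `GammaMonomial` of level `N` is a list of (index, exponent) pairs encoding `∏ Γ(k/N)^{e_k}`.
The *one-dimensional lattice* `D_N` is generated by reflections `e_k + e_{N-k}`, Gauss multiplication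
units `Σ_{j<d} e_{k+jN/d} - e_{dk}` (`d ∣ N`, `d > 1`) and two-term Beta units `β(a,b) - β(a',b')`
for Fermat triples of level `N` with the same CM type
`H(a,b) = {u ∈ (ℤ/N)ˣ : ⟨ua⟩ + ⟨ub⟩ + ⟨u(-a-b)⟩ = N}`.  A vector outside `D_N` admits no
cancellation-free derivation in the Beta-product move groupoid at level `N` (LEMMA 8.1).

The level-44 exceptional class is
`v44 = Γ(3/44)Γ(7/44)Γ(11/44) / (Γ(5/44)Γ(8/44)Γ(9/44)Γ(21/44))` (constant Koblitz–Ogus sums `-22`,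
i.e. an algebraic multiple of `π^{-1/2}`); its pull-back to level 88 is `v44at88` (indices doubled).
The separating functional is Seo's valuation functional at the prime 11 in combinatorial form: the
parity of the number of factors `Γ(k/N)^{±1}` whose argument has reduced denominator exactly `11`,
i.e. `4 ∣ k` at level 44 and `8 ∣ k` at level 88.
* `lr44_*`: at level 44 the functional is even on all reflection and multiplication generators and on
  all two-term units (322 Fermat triples, 224 CM types: equal CM type ⇒ equal parity), odd on `v44`;
  so `v44 ∉ D₄₄` although two-term units do exist at level 44.
* `lr88_*`: the same at level 88 (1290 triples, 1086 CM types; checked bucket-wise by CM key mod 128), so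
  `v44at88 ∉ D₈₈`: level-raising to 88 does not rescue the level-44 relation (contrast: level 33 → 66).
-/

namespace Summit.KontsevichZagierPeriods.KontsevichZagierPeriods.Theorems
namespace SoloBlind
namespace LevelRaising44

/-- A Γ-monomial of level `N` as a list of (index, exponent) pairs; indices are read mod `N`. -/
abbrev GammaMonomial := List (ℕ × ℤ)

/-- Koblitz–Ogus sum `S_u(e) = Σ e_k ⟨u k⟩_N`. -/
def koSumOf (N u : ℕ) (e : GammaMonomial) : ℤ :=
  e.foldl (fun acc kc => acc + kc.2 * (((u * kc.1) % N : ℕ) : ℤ)) 0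

/-- The units mod `N` in `1 … N-1`. -/
def unitsMod (N : ℕ) : List ℕ := (List.range N).filter fun u => Nat.gcd u N == 1

/-- `v44 = e₃ - e₅ + e₇ - e₈ - e₉ + e₁₁ - e₂₁` (level 44). -/
def v44 : GammaMonomial := [(3, 1), (5, -1), (7, 1), (8, -1), (9, -1), (11, 1), (21, -1)]

/-- The pull-back of `v44` to level 88: `Γ(k/44) = Γ(2k/88)`. -/
def v44at88 : GammaMonomial := v44.map fun kc => (2 * kc.1, kc.2)

/-- Parity functional: is `Σ_{q ∣ k, N ∤ k} e_k` even?  (`(N,q) = (44,4)` and `(88,8)`: the number of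
factors with argument of reduced denominator `11`.) -/
def wEven (N q : ℕ) (e : GammaMonomial) : Bool :=
  (e.foldl (fun acc kc => if kc.1 % N != 0 && (kc.1 % N) % q == 0 then acc + kc.2 else acc) 0) % 2 == 0

/-- Reflection generators `e_k + e_{N-k}`, `1 ≤ k ≤ N/2`. -/
def reflGens (N : ℕ) : List GammaMonomial :=
  ((List.range (N / 2)).map fun i => [(i + 1, (1 : ℤ)), (N - (i + 1), 1)])

/-- Gauss multiplication generators `Σ_{j<d} e_{k + jN/d} - e_{dk}` for `d ∣ N`, `d > 1`, `1 ≤ k < N/d`. -/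
def multGens (N : ℕ) : List GammaMonomial :=
  (((List.range (N + 1)).filter fun d => 1 < d && N % d == 0).map fun d =>
    (List.range (N / d - 1)).map fun i =>
      let k := i + 1
      ((List.range d).map fun j => (k + j * (N / d), (1 : ℤ))) ++ [(d * k, (-1 : ℤ))]).flatten

/-- CM type of the Fermat triple `(a, b, -a-b)` of level `N`, encoded as a bitmask over the units. -/
def cmKey (N a b : ℕ) : ℕ :=
  (unitsMod N).foldl (fun acc u =>
    2 * acc + (if (u * a) % N + (u * b) % N + (u * (N * N - a - b)) % N == N then 1 else 0)) 0

/-- Fermat triples of level `N` as multisets: `1 ≤ a ≤ b ≤ c ≤ N-1`, `a + b + c ≡ 0 (mod N)`. -/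
def fermatTriples (N : ℕ) : List (ℕ × ℕ × ℕ) :=
  (List.range N).flatMap fun a => (List.range N).filterMap fun b =>
    let c := (N * N - a - b) % N
    if 1 ≤ a && a ≤ b && b ≤ c then some (a, b, c) else none

/-- Parity of the number of entries of a triple divisible by `q`. -/
def tripleParity (q : ℕ) (t : ℕ × ℕ × ℕ) : Bool :=
  ((if t.1 % q == 0 then 1 else 0) + (if t.2.1 % q == 0 then 1 else 0)
    + (if t.2.2 % q == 0 then 1 else 0)) % 2 == 1

/-- Table of (CM type, parity of the number of entries divisible by `q`) over the Fermat triples of level `N`. -/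
def cmTable (N q : ℕ) : List (ℕ × Bool) :=
  (fermatTriples N).map fun t => (cmKey N t.1 t.2.1, tripleParity q t)

/-- The level-44 table (`q = 4`). -/
def cmTable44 : List (ℕ × Bool) := cmTable 44 4

/-- The level-88 table (`q = 8`). -/
def cmTable88 : List (ℕ × Bool) := cmTable 88 8

/-- Consistency of rows `lo … lo+len-1` of a table against the whole table: equal CM type ⇒ equal parity. -/
def chunkOK (tbl : List (ℕ × Bool)) (lo len : ℕ) : Bool :=
  ((tbl.drop lo).take len).all fun x => tbl.all fun y => x.1 != y.1 || x.2 == y.2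

/-- Bucketed consistency check: rows whose CM key is `≡ r (mod m)` are pairwise consistent
(equal CM type ⇒ equal parity).  Ranging over all residues `r < m` this is equivalent to consistency of
the whole table, since equal keys fall into the same bucket. -/
def bucketOK (tbl : List (ℕ × Bool)) (m r : ℕ) : Bool :=
  let b := tbl.filter fun x => x.1 % m == r
  b.all fun x => b.all fun y => x.1 != y.1 || x.2 == y.2

set_option maxRecDepth 8192 in
/-- There are 322 Fermat triples of level 44 and 1290 of level 88 (as multisets). -/
theorem triples_card : (fermatTriples 44).length = 322 ∧ (fermatTriples 88).length = 1290 := by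
  refine ⟨?_, ?_⟩ <;> decide +kernel

set_option maxRecDepth 8192 in
/-- `v44` has constant Koblitz–Ogus sums `-22` at level 44 (all 20 units). -/
theorem lr44_koUnit : ((unitsMod 44).all fun u => koSumOf 44 u v44 == -22) = true := by decide

set_option maxRecDepth 8192 in
/-- `v44at88` has constant Koblitz–Ogus sums `-44` at level 88 (all 40 units). -/
theorem lr88_koUnit : ((unitsMod 88).all fun u => koSumOf 88 u v44at88 == -44) = true := by decide

set_option maxRecDepth 8192 in
/-- Level 44: the functional is even on the 22 reflection generators. -/
theorem lr44_refl_even : ((reflGens 44).all (wEven 44 4)) = true := by decide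

set_option maxRecDepth 16384 in
/-- Level 44: the functional is even on the multiplication generators (`d = 2, 4, 11, 22, 44`). -/
theorem lr44_mult_even : ((multGens 44).all (wEven 44 4)) = true := by decide +kernel

set_option maxRecDepth 8192 in
/-- Level 44: the functional is odd on `v44` (exactly one factor, `Γ(8/44)⁻¹ = Γ(2/11)⁻¹`). -/
theorem lr44_v_odd : wEven 44 4 v44 = false := by decide

set_option maxRecDepth 65536 in
set_option maxHeartbeats 40000000 in
/-- Level 44: Fermat triples with the same CM type have the same parity of the number of entries
divisible by 4 (all 322 rows against all); so the functional is even on every two-term unit of level 44. -/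
theorem lr44_twoTerm_even : chunkOK cmTable44 0 322 = true := by decide +kernel

set_option maxRecDepth 8192 in
/-- Level 88: the functional is even on the 44 reflection generators. -/
theorem lr88_refl_even : ((reflGens 88).all (wEven 88 8)) = true := by decide

set_option maxRecDepth 16384 in
/-- Level 88: the functional is even on the multiplication generators (`d = 2, 4, 8, 11, 22, 44, 88`). -/
theorem lr88_mult_even : ((multGens 88).all (wEven 88 8)) = true := by decide +kernel

set_option maxRecDepth 8192 in
/-- Level 88: the functional is odd on `v44at88` (exactly one factor, `Γ(16/88)⁻¹`). -/
theorem lr88_v_odd : wEven 88 8 v44at88 = false := by decide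

set_option maxRecDepth 65536 in
set_option maxHeartbeats 40000000 in
/-- Level 88: within every bucket of CM keys mod 128, Fermat triples with the same CM type have the same
parity of the number of entries divisible by 8; since equal keys share a bucket, this is the full statement:
the functional is even on every two-term unit of level 88 and, with `lr88_refl_even`, `lr88_mult_even`,
`lr88_v_odd`, the pull-back `v44at88` is not in `D₈₈`. -/
theorem lr88_twoTerm_even : ((List.range 128).all (bucketOK cmTable88 128)) = true := by decide +kernel

set_option maxRecDepth 65536 in
set_option maxHeartbeats 40000000 in
/-- Level 44, bucket form (keys mod 32) of `lr44_twoTerm_even`. -/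
theorem lr44_twoTerm_even' : ((List.range 32).all (bucketOK cmTable44 32)) = true := by decide +kernel

end LevelRaising44
end SoloBlind
end Summit.KontsevichZagierPeriods.KontsevichZagierPeriods.Theorems
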